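import Summits.RiemannHypothesis.RiemannHypothesis.Theses.WeilComb
import Summits.RiemannHypothesis.RiemannHypothesis.Theorems.WeilCombCombShapePositivityStubArchWindow
import Summits.RiemannHypothesis.RiemannHypothesis.Theorems.WeilCombCombShapePositivityArchGram
import Summits.RiemannHypothesis.RiemannHypothesis.Theorems.WeilCombCombShapePositivityStubSubDiagPole
import Summits.RiemannHypothesis.RiemannHypothesis.Theorems.WeilCombCombShapePositivityStubSubOffdiag
import Literature.NumberTheory.LFunctions.WeilExplicit
import Literature.NumberTheory.LFunctions.WeilMellinBounds
import Literature.NumberTheory.LFunctions.WeilArchimedeanMoments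
import Literature.Analysis.SpecialFunctions.DigammaVerticalSeries

/-!
# An integral-free upper bound for the archimedean coherence deficit on the half-window `4εM ≤ 1`
(crux `WeilComb.CombShapePositivity`, item stmt-RiemannHypothesis-11229, line `Sketch`)

Notation. `φ₀(u) = expNegInvGlue (1 - u²)`, `φ_ε(t) = ε⁻¹ φ₀(t/ε)`, `ψ_ε = φ_ε ⋆ φ̃_ε`, comb `g = Σ_{m ≤ M} a_m φ_ε(· − log m)`,
`k = g ⋆ g̃`, `N₀ = ‖φ₀‖₂²`, `U = ε⁻¹N₀`, `I₀ = ∫ φ₀`, `L = Σ‖a_m‖²`, `ρ(u) = Re ψ(1/4 + iu/2)` (`reDigammaQuarter`),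
`archPlus(a) = (1/2π)∫|ĝ(1/2+iu)|²(ρ(u) − ρ(0))du`, coherence deficit `Δ(a) = (log M + 1 + log π − ρ(0))L − archPlus(a)/U`,
`B_abs(a) = Σ_{m ≠ m'} ‖a_m‖‖a_{m'}‖/|log m − log m'|` (absolute logarithmic-Hilbert form), `S₁ = Σ‖a_m‖`.

**Statement** (`coherenceDeficit_le`). For `0 < ε`, `1 ≤ M`, `4εM ≤ 1` and every `a`:
`Δ(a) ≤ (log M + 1 − log(1/ε) + 5/2 + ε(9 + 3 log(1/ε)))·L + (ε I₀²/N₀)·(B_abs(a) + S₁²)`,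
i.e. `Δ(a) ≤ (log(εM) + 7/2 + o(1))‖a‖² + 2r₀ε(B_abs + S₁²)`, `r₀ = I₀²/2N₀ ≈ 0.74`. Together with the landed dichotomy
`window_dichotomy_rank2` (p101483: off the cone `D ≤ Δ + C₂L` the cell holds) this makes the localisation of Theorem B an
INTEGRAL-FREE arithmetic statement on the half-window: a vector at which the comb form could be negative has Dirichlet
energy `D(a) ≤ (log(εM) + 7/2 + C₂ + o(1))‖a‖² + 2r₀ε(B_abs(a) + S₁(a)²)` — small multiplicative energy relative to its
logarithmic-Hilbert (archimedean near-diagonal) energy.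

**Proof.** `archPlus = Re W_∞(k) + (log π − ρ(0))UL` (`stub_arch_window`, p99537); the archimedean Gram form
`W_∞(k) = Σ_{m,m'} a_m conj a_{m'} W_∞(τ_{log m − log m'} ψ_ε)` (p91497) splits into the diagonal `L·W_∞(ψ_ε)` and the
off-diagonal part; `Re W_∞(ψ_ε) ≥ U(log(1/ε) − 5/2) − N₀(9 + 3 log(1/ε))` (`stub_subDiagPole`, p102469, `ε ≤ 1/4`) and
`Re Σ_{m≠m'} ≥ −I₀²(B_abs + S₁²)` (`stub_subOffdiag`, p98309, `4εM ≤ 1`).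
-/

noncomputable section

-- the sub-problem path `RiemannHypothesis/RiemannHypothesis` (single-conjunct summit, D-0017) duplicates a namespace
set_option linter.dupNamespace false

open scoped BigOperators ComplexConjugate
open Complex MeasureTheory

namespace Summit.RiemannHypothesis.RiemannHypothesis.Theorems.WeilCombBohrFejer

open Literature.NumberTheory.LFunctions
open Literature.Analysis.SpecialFunctions (reDigammaQuarter)

/-- Translation by `0` is the identity. [folklore] -/
private theorem weilTranslate_zero_cdb (h : ℝ → ℂ) : weilTranslate h 0 = h := by
  funext t
  simp [weilTranslate]

/-- The Gram double sum splits into its diagonal and its off-diagonal part. [folklore] -/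
private theorem sum_sum_eq_diag_add_offdiag_cdb (S : Finset ℕ) (f : ℕ → ℕ → ℂ) :
    ∑ m ∈ S, ∑ m' ∈ S, f m m' = ∑ m ∈ S, f m m + ∑ m ∈ S, ∑ m' ∈ S.erase m, f m m' := by
  rw [← Finset.sum_add_distrib]
  refine Finset.sum_congr rfl fun m hm => ?_
  rw [← Finset.add_sum_erase S (f m) hm]

/-- **Upper bound for the coherence deficit (integral-free).** For `0 < ε`, `1 ≤ M`, `4εM ≤ 1`, every `a`:
`(log M + 1 + log π − ρ(0))‖a‖² − (ε/‖φ₀‖₂²)·archPlus(a)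
 ≤ (log M + 1 − log(1/ε) + 5/2 + ε(9 + 3 log(1/ε)))‖a‖² + (ε I₀²/‖φ₀‖₂²)(B_abs(a) + S₁(a)²)`. [folklore] -/
theorem coherenceDeficit_le : ∀ ε : ℝ, 0 < ε → ∀ (M : ℕ) (a : ℕ → ℂ), 1 ≤ M → 4 * ε * M ≤ 1 →
    (Real.log M + 1 + Real.log Real.pi - reDigammaQuarter 0) * (∑ m ∈ Finset.Icc 1 M, ‖a m‖ ^ 2) -
        ε / weilNorm2Sq (fun u : ℝ => ((expNegInvGlue (1 - u ^ 2) : ℝ) : ℂ)) *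
          (1 / (2 * Real.pi) * ∫ u : ℝ, ‖weilMellin (fun x : ℝ => ∑ m ∈ Finset.Icc 1 M,
            a m * ((ε : ℂ)⁻¹ * ((expNegInvGlue (1 - ((x - Real.log (m : ℝ)) / ε) ^ 2) : ℝ) : ℂ)))
              (1 / 2 + u * I)‖ ^ 2 * (reDigammaQuarter u - reDigammaQuarter 0)) ≤
      (Real.log M + 1 - Real.log (1 / ε) + 5 / 2 + ε * (9 + 3 * Real.log (1 / ε))) *
          (∑ m ∈ Finset.Icc 1 M, ‖a m‖ ^ 2) +
        ε * (∫ u : ℝ, expNegInvGlue (1 - u ^ 2)) ^ 2 /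
            weilNorm2Sq (fun u : ℝ => ((expNegInvGlue (1 - u ^ 2) : ℝ) : ℂ)) *
          ((∑ m ∈ Finset.Icc 1 M, ∑ m' ∈ (Finset.Icc 1 M).erase m,
              ‖a m‖ * ‖a m'‖ / |Real.log m - Real.log m'|) +
            (∑ m ∈ Finset.Icc 1 M, ‖a m‖) ^ 2) := by
  intro ε hε M a hM h4
  have hMr : (1 : ℝ) ≤ (M : ℝ) := by exact_mod_cast hM
  -- the half-window lies inside the exact window, and `ε ≤ 1/4`
  have hw : 2 * ε * ((M : ℝ) + 1) ≤ 1 := by nlinarith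
  have hε4 : ε ≤ 1 / 4 := by nlinarith
  -- landed inputs
  have hAr := stub_arch_window ε hε M a hw
  have hGram := weilArchTerm_comb_eq_sum ε hε M a
  have hDiag := stub_subDiagPole.1 ε hε hε4
  have hOff := stub_subOffdiag ε hε M a h4
  -- split the Gram form into diagonal + off-diagonal and take real parts
  rw [sum_sum_eq_diag_add_offdiag_cdb] at hGram
  have hdiag : ∀ m ∈ Finset.Icc 1 M,
      a m * conj (a m) *
          weilArchTerm (weilTranslate
            (weilConv (fun t : ℝ => (ε : ℂ)⁻¹ * ((expNegInvGlue (1 - (t / ε) ^ 2) : ℝ) : ℂ))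
              (weilReflect (fun t : ℝ => (ε : ℂ)⁻¹ * ((expNegInvGlue (1 - (t / ε) ^ 2) : ℝ) : ℂ))))
            (Real.log (m : ℝ) - Real.log (m : ℝ))) =
        ((‖a m‖ ^ 2 : ℝ) : ℂ) *
          weilArchTerm
            (weilConv (fun t : ℝ => (ε : ℂ)⁻¹ * ((expNegInvGlue (1 - (t / ε) ^ 2) : ℝ) : ℂ))
              (weilReflect (fun t : ℝ => (ε : ℂ)⁻¹ * ((expNegInvGlue (1 - (t / ε) ^ 2) : ℝ) : ℂ)))) := by
    intro m _
    rw [sub_self, weilTranslate_zero_cdb, Complex.mul_conj, Complex.normSq_eq_norm_sq]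
  rw [Finset.sum_congr rfl hdiag, ← Finset.sum_mul] at hGram
  -- real part of the archimedean term
  have hRe : (weilArchTerm
      (weilConv (fun x : ℝ => ∑ m ∈ Finset.Icc 1 M,
          a m * ((ε : ℂ)⁻¹ * ((expNegInvGlue (1 - ((x - Real.log (m : ℝ)) / ε) ^ 2) : ℝ) : ℂ)))
        (weilReflect (fun x : ℝ => ∑ m ∈ Finset.Icc 1 M,
          a m * ((ε : ℂ)⁻¹ * ((expNegInvGlue (1 - ((x - Real.log (m : ℝ)) / ε) ^ 2) : ℝ) : ℂ)))))).re =
      (∑ m ∈ Finset.Icc 1 M, ‖a m‖ ^ 2) *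
          (weilArchTerm
            (weilConv (fun t : ℝ => (ε : ℂ)⁻¹ * ((expNegInvGlue (1 - (t / ε) ^ 2) : ℝ) : ℂ))
              (weilReflect (fun t : ℝ => (ε : ℂ)⁻¹ * ((expNegInvGlue (1 - (t / ε) ^ 2) : ℝ) : ℂ))))).re +
        (∑ m ∈ Finset.Icc 1 M, ∑ m' ∈ (Finset.Icc 1 M).erase m,
          a m * conj (a m') *
            weilArchTerm (weilTranslate
              (weilConv (fun t : ℝ => (ε : ℂ)⁻¹ * ((expNegInvGlue (1 - (t / ε) ^ 2) : ℝ) : ℂ))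
                (weilReflect (fun t : ℝ => (ε : ℂ)⁻¹ * ((expNegInvGlue (1 - (t / ε) ^ 2) : ℝ) : ℂ))))
              (Real.log (m : ℝ) - Real.log (m' : ℝ)))).re := by
    rw [hGram, Complex.add_re]
    congr 1
    rw [← Complex.ofReal_sum, Complex.re_ofReal_mul]
  -- names for the real atoms
  rw [hRe] at hAr
  set N₀ : ℝ := weilNorm2Sq (fun u : ℝ => ((expNegInvGlue (1 - u ^ 2) : ℝ) : ℂ)) with hN₀
  set I₀ : ℝ := ∫ u : ℝ, expNegInvGlue (1 - u ^ 2) with hI₀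
  set L : ℝ := ∑ m ∈ Finset.Icc 1 M, ‖a m‖ ^ 2 with hL
  set Wd : ℝ := (weilArchTerm
      (weilConv (fun t : ℝ => (ε : ℂ)⁻¹ * ((expNegInvGlue (1 - (t / ε) ^ 2) : ℝ) : ℂ))
        (weilReflect (fun t : ℝ => (ε : ℂ)⁻¹ * ((expNegInvGlue (1 - (t / ε) ^ 2) : ℝ) : ℂ))))).re with hWd
  set Off : ℝ := (∑ m ∈ Finset.Icc 1 M, ∑ m' ∈ (Finset.Icc 1 M).erase m,
      a m * conj (a m') *
        weilArchTerm (weilTranslate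
          (weilConv (fun t : ℝ => (ε : ℂ)⁻¹ * ((expNegInvGlue (1 - (t / ε) ^ 2) : ℝ) : ℂ))
            (weilReflect (fun t : ℝ => (ε : ℂ)⁻¹ * ((expNegInvGlue (1 - (t / ε) ^ 2) : ℝ) : ℂ))))
          (Real.log (m : ℝ) - Real.log (m' : ℝ)))).re with hOffdef
  set B : ℝ := (∑ m ∈ Finset.Icc 1 M, ∑ m' ∈ (Finset.Icc 1 M).erase m,
      ‖a m‖ * ‖a m'‖ / |Real.log m - Real.log m'|) + (∑ m ∈ Finset.Icc 1 M, ‖a m‖) ^ 2 with hB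
  set P : ℝ := 1 / (2 * Real.pi) * ∫ u : ℝ, ‖weilMellin (fun x : ℝ => ∑ m ∈ Finset.Icc 1 M,
      a m * ((ε : ℂ)⁻¹ * ((expNegInvGlue (1 - ((x - Real.log (m : ℝ)) / ε) ^ 2) : ℝ) : ℂ)))
        (1 / 2 + u * I)‖ ^ 2 * (reDigammaQuarter u - reDigammaQuarter 0) with hP
  have hN₀pos : 0 < N₀ := by
    -- `I₀² ≤ 2N₀` with `I₀ > 0` would do; simplest: the landed positivity of `∫ φ₀ cosh` at any ε is not imported,
    -- so use `I₀² ≤ 2 N₀` (stub_subDiagPole) and `I₀ > 0`.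
    have hI2 := stub_subDiagPole.2.2
    have hI0 : 0 < I₀ := by
      rw [hI₀]
      have hc : Continuous fun u : ℝ => expNegInvGlue (1 - u ^ 2) :=
        (expNegInvGlue.contDiff (n := 0)).continuous.comp (continuous_const.sub (continuous_id.pow 2))
      have hs : HasCompactSupport fun u : ℝ => expNegInvGlue (1 - u ^ 2) := by
        refine HasCompactSupport.of_support_subset_isCompact (isCompact_Icc (a := -1) (b := 1)) ?_
        intro u hu
        by_contra h
        apply hu
        have h1 : 1 - u ^ 2 ≤ 0 := by
          simp only [Set.mem_Icc, not_and_or, not_le] at h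
          rcases h with h | h <;> nlinarith
        exact expNegInvGlue.zero_of_nonpos h1
      exact hc.integral_pos_of_hasCompactSupport_nonneg_nonzero hs (fun u => expNegInvGlue.nonneg _) (x := 0)
        (expNegInvGlue.pos_of_pos (by norm_num)).ne'
    have : 0 < I₀ ^ 2 := by positivity
    rw [← hI₀, ← hN₀] at hI2
    linarith
  have hL0 : 0 ≤ L := Finset.sum_nonneg fun _ _ => by positivity
  -- `U = ε⁻¹ N₀`, `ε/N₀ = U⁻¹`
  have hεU : 0 < ε⁻¹ * N₀ := mul_pos (inv_pos.2 hε) hN₀pos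
  -- assemble: `P = L·Wd + Off − (ρ₀ − log π)·U·L`, `Wd ≥ U(log(1/ε) − 5/2) − N₀(9 + 3 log(1/ε))`, `Off ≥ −I₀²B`
  have hP_eq : P = L * Wd + Off - (reDigammaQuarter 0 - Real.log Real.pi) * (ε⁻¹ * N₀ * L) := by
    rw [hP]
    linarith [hAr]
  have hDiag' : ε⁻¹ * N₀ * (Real.log (1 / ε) - 5 / 2) - N₀ * (9 + 3 * Real.log (1 / ε)) ≤ Wd := hDiag
  have hOff' : -(I₀ ^ 2 * B) ≤ Off := hOff
  -- multiply the diagonal bound by `L ≥ 0`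
  have hDiagL := mul_le_mul_of_nonneg_left hDiag' hL0
  -- the claim, after clearing `ε/N₀`
  have hεN : ε / N₀ * P = ε / N₀ * (L * Wd) + ε / N₀ * Off -
      (reDigammaQuarter 0 - Real.log Real.pi) * L := by
    rw [hP_eq]
    field_simp
  rw [hεN]
  have hc1 : ε / N₀ * (L * Wd) ≥ L * (Real.log (1 / ε) - 5 / 2) - ε * (9 + 3 * Real.log (1 / ε)) * L := by
    have := mul_le_mul_of_nonneg_left hDiagL (div_nonneg hε.le hN₀pos.le)
    have e : ε / N₀ * (L * (ε⁻¹ * N₀ * (Real.log (1 / ε) - 5 / 2) - N₀ * (9 + 3 * Real.log (1 / ε)))) =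
        L * (Real.log (1 / ε) - 5 / 2) - ε * (9 + 3 * Real.log (1 / ε)) * L := by
      field_simp
    linarith [this, e]
  have hc2 : ε / N₀ * Off ≥ -(ε * I₀ ^ 2 / N₀ * B) := by
    have := mul_le_mul_of_nonneg_left hOff' (div_nonneg hε.le hN₀pos.le)
    have e : ε / N₀ * -(I₀ ^ 2 * B) = -(ε * I₀ ^ 2 / N₀ * B) := by ring
    linarith [this, e]
  nlinarith [hc1, hc2]

end Summit.RiemannHypothesis.RiemannHypothesis.Theorems.WeilCombBohrFejer

end
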